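import Summits.QuantumFields.GaugeBoot.TiltedBoxLimitLoopEquation
import HarnessLib

/-!
# Infinite-volume limit points of the 45°-tilted boxes, part 15: the `U(N)` loop equations

HONEST FRAMING (cell `pub-gaugeboot`, page 1 of every file): the venture produces certified bounds
on lattice expectations at stated coupling, gauge group, dimension and torus size; NOT a mass gap,
NOT a continuum limit, NOT a string tension; NOT Yang–Mills-summit-bearing (barriers
`FixedCouplingUltralocality`, `PerturbativeInvisibility`). The `U(N)` twin of
`TiltedBoxLimitLoopEquation.lean`; nothing else is claimed.

**`loopEquation_pairForm_uN_of_mem_tiltedBoxLimitPoints`.** For `G = U(N)` (defining representation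
`unitaryFundamentalRep (Fin N) ℂ`), every real `β`, every tilted limit point
`μ ∈ tiltedBoxLimitPoints d i j ρ β` (`i ≠ j`), every site `x`, axis `a` and word `w` closed at `x` on
`ℤ^d`: the single-link loop equation in real pair normal form (`s = 0`: no `1/N²` and no pair plaquette
terms) — the identity `loopEquation_pairForm_unitaryGroup` of the boxes with `∫ … ∂μ` and the `ℤ^d` word
holonomies. Proof as for `SU(N)`.

References: V. Kazakov, Z. Zheng, JHEP 03 (2025) 099 §2.3; S. Chatterjee, Comm. Math. Phys. 366 (2019) Thm. 8.1.
-/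

noncomputable section

open MeasureTheory Filter Topology
open Literature.Probability.LatticeModels (Site)
open Literature.MathematicalPhysics.QuantumLattice

namespace Summit.QuantumFields.GaugeBoot

namespace TiltedRP

variable {d N : ℕ} {i j : Fin d}

/-- **THE `U(N)` SINGLE-LINK LOOP EQUATION IN REAL PAIR NORMAL FORM HOLDS FOR EVERY TILTED LIMIT POINT.** -/
theorem loopEquation_pairForm_uN_of_mem_tiltedBoxLimitPoints (hij : i ≠ j) (x : Site d) (a : Fin d)
    (w : Word d) (hw : GaugeBoot.Word.endpointZd x w = x) {β : ℝ}
    {μ : Measure (LGConfig d (Matrix.unitaryGroup (Fin N) ℂ))}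
    (hμ : μ ∈ tiltedBoxLimitPoints d i j (unitaryFundamentalRep (Fin N) ℂ) β) :
    (∑ k ∈ (Finset.range w.length).filter (w.fwdOccZ a),
        (∫ U, (unitaryFundamentalRep (Fin N) ℂ (wordHolonomyZd U x (w.take k))).trace *
              (unitaryFundamentalRep (Fin N) ℂ (wordHolonomyZd U x (w.drop k))).trace ∂μ).re / (N : ℝ) ^ 2) -
      (∑ k ∈ (Finset.range w.length).filter (w.bwdOccZ a),
        (∫ U, (unitaryFundamentalRep (Fin N) ℂ (wordHolonomyZd U x (w.take (k + 1)))).trace *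
              (unitaryFundamentalRep (Fin N) ℂ (wordHolonomyZd U x (w.drop (k + 1)))).trace ∂μ).re /
            (N : ℝ) ^ 2) +
      β / (2 * N) * ∑ ν ∈ Finset.univ.erase a, ∑ ε : Bool,
        ((N : ℝ)⁻¹ * (∫ U, (unitaryFundamentalRep (Fin N) ℂ
            (wordHolonomyZd U x (w ++ plaqWord a ν ε))).trace ∂μ).re -
          (N : ℝ)⁻¹ * (∫ U, (unitaryFundamentalRep (Fin N) ℂ
            (wordHolonomyZd U x (w ++ (plaqWord a ν ε).reverse))).trace ∂μ).re) = 0 := by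
  classical
  haveI : SecondCountableTopology (Matrix (Fin N) (Fin N) ℂ) :=
    inferInstanceAs (SecondCountableTopology (Fin N → Fin N → ℂ))
  haveI : SecondCountableTopology (Matrix.unitaryGroup (Fin N) ℂ) :=
    Topology.IsEmbedding.subtypeVal.secondCountableTopology
  have hρ : Continuous (unitaryFundamentalRep (Fin N) ℂ) :=
    continuous_unitaryFundamentalRep (n := Fin N) (𝕜 := ℂ)
  obtain ⟨M, Q, hM, hQ, h⟩ := hμ
  haveI := h.1
  have hW : ∀ v : Word d, Tendsto (fun k : ℕ =>
      (∫ V, (unitaryFundamentalRep (Fin N) ℂ (wordHolonomyZd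
        (tiltedLift d i j (M k + 2) (M k + 2) (2 * (Q k + 2)) V) x v)).trace
        ∂(gibbs (unitaryFundamentalRep (Fin N) ℂ)
          (tiltedUnit d i j (M k + 2) (M k + 2) (2 * (Q k + 2))) β)).re)
      atTop (𝓝 (∫ U, (unitaryFundamentalRep (Fin N) ℂ (wordHolonomyZd U x v)).trace ∂μ).re) := by
    intro v
    obtain ⟨S, hS⟩ := exists_dependsOn_wordHolonomyZd (G := Matrix.unitaryGroup (Fin N) ℂ) x v
    have hc : Continuous fun U : LGConfig d (Matrix.unitaryGroup (Fin N) ℂ) =>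
        (unitaryFundamentalRep (Fin N) ℂ (wordHolonomyZd U x v)).trace :=
      (hρ.comp (continuous_wordHolonomyZd x v)).matrix_trace
    obtain ⟨C, hC⟩ := exists_bound_of_continuous (continuous_norm.comp hc)
    exact h.tendsto_re_integral hρ (T := S) (fun U V hUV => by simp only [hS U V hUV]) hc
      (C := C) fun U => (le_abs_self _).trans (hC U)
  have hD : ∀ u v : Word d, Tendsto (fun k : ℕ =>
      (∫ V, (unitaryFundamentalRep (Fin N) ℂ (wordHolonomyZd
          (tiltedLift d i j (M k + 2) (M k + 2) (2 * (Q k + 2)) V) x u)).trace *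
        (unitaryFundamentalRep (Fin N) ℂ (wordHolonomyZd
          (tiltedLift d i j (M k + 2) (M k + 2) (2 * (Q k + 2)) V) x v)).trace
        ∂(gibbs (unitaryFundamentalRep (Fin N) ℂ)
          (tiltedUnit d i j (M k + 2) (M k + 2) (2 * (Q k + 2))) β)).re)
      atTop (𝓝 (∫ U, (unitaryFundamentalRep (Fin N) ℂ (wordHolonomyZd U x u)).trace *
        (unitaryFundamentalRep (Fin N) ℂ (wordHolonomyZd U x v)).trace ∂μ).re) := by
    intro u v
    obtain ⟨S₁, hS₁⟩ := exists_dependsOn_wordHolonomyZd (G := Matrix.unitaryGroup (Fin N) ℂ) x u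
    obtain ⟨S₂, hS₂⟩ := exists_dependsOn_wordHolonomyZd (G := Matrix.unitaryGroup (Fin N) ℂ) x v
    have hc : Continuous fun U : LGConfig d (Matrix.unitaryGroup (Fin N) ℂ) =>
        (unitaryFundamentalRep (Fin N) ℂ (wordHolonomyZd U x u)).trace *
          (unitaryFundamentalRep (Fin N) ℂ (wordHolonomyZd U x v)).trace :=
      (hρ.comp (continuous_wordHolonomyZd x u)).matrix_trace.mul
        (hρ.comp (continuous_wordHolonomyZd x v)).matrix_trace
    obtain ⟨C, hC⟩ := exists_bound_of_continuous (continuous_norm.comp hc)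
    refine h.tendsto_re_integral hρ (T := S₁ ∪ S₂) (fun U V hUV => ?_) hc
      (C := C) fun U => (le_abs_self _).trans (hC U)
    simp only [hS₁ U V fun e he => hUV e (by rw [Finset.coe_union]; exact Or.inl he),
      hS₂ U V fun e he => hUV e (by rw [Finset.coe_union]; exact Or.inr he)]
  have hev : ∀ᶠ k : ℕ in atTop,
      (∑ k' ∈ (Finset.range w.length).filter (w.fwdOccZ a),
        (∫ V, (unitaryFundamentalRep (Fin N) ℂ (wordHolonomyZd
              (tiltedLift d i j (M k + 2) (M k + 2) (2 * (Q k + 2)) V) x (w.take k'))).trace *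
            (unitaryFundamentalRep (Fin N) ℂ (wordHolonomyZd
              (tiltedLift d i j (M k + 2) (M k + 2) (2 * (Q k + 2)) V) x (w.drop k'))).trace
            ∂(gibbs (unitaryFundamentalRep (Fin N) ℂ)
              (tiltedUnit d i j (M k + 2) (M k + 2) (2 * (Q k + 2))) β)).re / (N : ℝ) ^ 2) -
      (∑ k' ∈ (Finset.range w.length).filter (w.bwdOccZ a),
        (∫ V, (unitaryFundamentalRep (Fin N) ℂ (wordHolonomyZd
              (tiltedLift d i j (M k + 2) (M k + 2) (2 * (Q k + 2)) V) x (w.take (k' + 1)))).trace *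
            (unitaryFundamentalRep (Fin N) ℂ (wordHolonomyZd
              (tiltedLift d i j (M k + 2) (M k + 2) (2 * (Q k + 2)) V) x (w.drop (k' + 1)))).trace
            ∂(gibbs (unitaryFundamentalRep (Fin N) ℂ)
              (tiltedUnit d i j (M k + 2) (M k + 2) (2 * (Q k + 2))) β)).re / (N : ℝ) ^ 2) +
      β / (2 * N) * ∑ ν ∈ Finset.univ.erase a, ∑ ε : Bool,
        ((N : ℝ)⁻¹ * (∫ V, (unitaryFundamentalRep (Fin N) ℂ (wordHolonomyZd
              (tiltedLift d i j (M k + 2) (M k + 2) (2 * (Q k + 2)) V) x (w ++ plaqWord a ν ε))).trace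
            ∂(gibbs (unitaryFundamentalRep (Fin N) ℂ)
              (tiltedUnit d i j (M k + 2) (M k + 2) (2 * (Q k + 2))) β)).re -
          (N : ℝ)⁻¹ * (∫ V, (unitaryFundamentalRep (Fin N) ℂ (wordHolonomyZd
              (tiltedLift d i j (M k + 2) (M k + 2) (2 * (Q k + 2)) V) x
                (w ++ (plaqWord a ν ε).reverse))).trace
            ∂(gibbs (unitaryFundamentalRep (Fin N) ℂ)
              (tiltedUnit d i j (M k + 2) (M k + 2) (2 * (Q k + 2))) β)).re) = 0 := by
    filter_upwards [hM.eventually_ge_atTop w.length, hQ.eventually_ge_atTop w.length] with k hkM hkQ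
    have hsm := smallFor_tiltedUnit_of_dispBound d (M k + 2) (M k + 2) (2 * (Q k + 2)) hij
      (dispBound_length d w) (by omega) (by omega) (by omega)
    have hwk : Word.endpoint (tiltedUnit d i j (M k + 2) (M k + 2) (2 * (Q k + 2)))
        (x : TiltedSite d i j (M k + 2) (M k + 2) (2 * (Q k + 2))) w = (x : TiltedSite d i j _ _ _) := by
      rw [endpoint_mk, hw]
    have hbox := loopEquation_pairForm_unitaryGroup N
      (tiltedUnit d i j (M k + 2) (M k + 2) (2 * (Q k + 2))) β (x : TiltedSite d i j _ _ _) a w hwk hsm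
    simpa only [wordHolonomy_mk] using hbox
  have hlim := ((tendsto_finsetSum ((Finset.range w.length).filter (w.fwdOccZ a))
      (fun k' _ => (hD (w.take k') (w.drop k')).div_const ((N : ℝ) ^ 2))).sub
    (tendsto_finsetSum ((Finset.range w.length).filter (w.bwdOccZ a))
      (fun k' _ => (hD (w.take (k' + 1)) (w.drop (k' + 1))).div_const ((N : ℝ) ^ 2)))).add
    ((tendsto_finsetSum (Finset.univ.erase a) fun ν _ => tendsto_finsetSum Finset.univ fun ε _ =>
      ((hW (w ++ plaqWord a ν ε)).const_mul ((N : ℝ)⁻¹)).sub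
        ((hW (w ++ (plaqWord a ν ε).reverse)).const_mul ((N : ℝ)⁻¹))).const_mul (β / (2 * N)))
  exact (tendsto_nhds_unique (tendsto_const_nhds.congr' (hev.mono fun k hk => hk.symm)) hlim).symm

end TiltedRP

end Summit.QuantumFields.GaugeBoot
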